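import Literature.AlgebraicGeometry.Modules.CechComplexExactOfFibrewiseExact
import Mathlib.AlgebraicGeometry.Morphisms.FiniteType
import Mathlib.RingTheory.Jacobson.Ring
import HarnessLib

/-!
# Fibrewise exact at every `k`-POINT ⇒ exact after every base change (finite-type affine base over `k = k̄`), and the point
# form of the conclusion — the geometric readings (E1′)∕(E1″) of ★ `CechComplexExactOfFibrewiseExact` (Mumford AV §5 Cor. 3)

Topic `AlgebraicGeometry/Modules`; namespace `Literature.AlgebraicGeometry.Modules`.  THEOREMS ONLY (no definition, no named fact, no
instance, no notation, no `sorry`); books 0.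

Cell hodgecm-mathlib (D-0151), P6 «MOD programme», DUAL-S road (A), **brick (CBC-1), sequel file** of B-p08 (g33)'s «CBC CUT» (memo v1 +
INTERFACE WORD 2026-09-02T00:10Z (S1)–(S4) + ADDENDUM 00:11Z): the consumer (CBC-4) «PIC0-ONTO, any characteristic», [MumfordAV1970] §8 Thm. 1)
computes FIBRES at `k`-points as Mathlib chosen pullbacks (S2) — for `g : X ⟶ B` and `b : Spec k ⟶ B` the fibre Čech complex of a family
`𝓤` and a module `G` is `Modules.cechComplex (fun j => (pullback.fst g b) ⁻¹ᵁ 𝓤 j) ((Scheme.Modules.pullback (pullback.fst g b)).obj G)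
(pullback.snd g b)♯` (scalars are free, (S3)) — and needs the step «exact at every `k`-point ⇒ exact» over the AFFINE pieces of a finite
affine cover of an abelian variety over `k = k̄` (option (ii) of (S4): B-p08 restricts to the open pieces in CBC-4).  B-p04 (g40).  HC_CM is
proved only modulo the printed citations (2 remaining named inputs hLiu418 24832, h413 24833) until rung 0 closes; count-neutral capital.

* §1 `k`-POINTS OF AN AFFINE `k`-SCHEME OF FINITE TYPE, `k = k̄` (Hilbert's Nullstellensatz, [GortzWedhorn2020] Cor. 3.36; Mathlib
  `finite_of_finite_type_of_isJacobsonRing` + `IsAlgClosed.algebraMap_bijective_of_isIntegral`): every maximal ideal `𝔪 ⊂ Γ(B, 𝒪_B)` is the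
  kernel of a `k`-algebra map `ev : Γ(B) → k` (`exists_algHom_ker_eq_of_isMaximal_sections`), whose point
  `b_ev := Spec ev ≫ B.isoSpec⁻¹ : Spec k → B` lies over `k` (`specMap_comp_isoSpec_inv_comp_eq_id`) and has
  `b_ev♯ = ev ≫ (ΓSpecIso k)⁻¹` (`appLE_specMap_comp_isoSpec_inv`); the test algebras `κ(𝔪)` and `Γ(Spec k, 𝒪)` (through `b_ev♯`) are
  `Γ(B)`-linearly isomorphic (`nonempty_residueField_linearEquiv_sections_spec`).
* §2 **(E1′) `cechComplex_exact_baseChange_of_forall_kPoint`**: `g : X → B` proper flat, `f : B → Spec k` affine of finite type, `k`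
  algebraically closed, `G` finite locally free, `𝓤` a finite cover of `X` with affine finite intersections; if for every `k`-point `b` of
  `B` over `k` (`b ≫ f = 𝟙`) the fibre Čech complex (S2) is exact in every degree `i ≥ q`, then `Č•(𝓤, G) ⊗_{Γ(B)} B'` is exact in every
  degree `i ≥ q` for EVERY `Γ(B)`-algebra `B'` (★ affine base change `exists_extendScalars_cechComplex_iso_of_isPullback` on
  `IsPullback.of_hasPullback g b`, ★ `exactAt_extendScalars_iff`, §1, ★ `function_exact_baseChange_iff_of_linearEquiv`, and ★ (E1)
  `cechComplex_exact_baseChange_of_forall_isMaximal`); **`cechComplex_exactAt_of_forall_kPoint`** — in particular `Hⁱ(Č•(𝓤, G)) = 0`, `i ≥ q`.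
* §3 **(E1″) `cechComplex_fibre_exactAt_of_forall_exact_baseChange`** — the point form of the conclusion: exactness after every base
  change gives back exactness of the fibre Čech complex at EVERY field-valued point `b : Spec K → B` (any field `K`, no `k = k̄`);
  **`cechComplex_fibre_exactAt_of_forall_kPoint`** — (E1′) read at an arbitrary field-valued point.
(The converse (E2) «exact ⇒ exact after every base change» for the flat Čech complex itself is the next sequel.)

## References
* [MumfordAV1970] D. Mumford, *Abelian Varieties* (1970), §5 Cor. 3 (p. 53) (and its use in §8 Thm. 1, p. 77).
* [Hartshorne1977] R. Hartshorne, *Algebraic Geometry* (1977), III Thm. 12.11 (p. 290).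
* [GortzWedhorn2020] U. Görtz, T. Wedhorn, *Algebraic Geometry I*, 2nd ed. (2020), Prop. 3.35, Cor. 3.36 (closed points = `k`-points over
  `k = k̄`), Prop. 4.16 ∕ Section (4.7) (fibres as pullbacks).
* [GortzWedhorn2023] U. Görtz, T. Wedhorn, *Algebraic Geometry II* (2023), Prop. 22.90 (p. 277) (affine base change of Čech complexes), Thm. 23.140.
* [AtiyahMacdonald1969] M. F. Atiyah, I. G. Macdonald (1969), Ch. 5 Cor. 5.24 / Ch. 7 Ex. (Zariski's lemma, Nullstellensatz).
* Tree: ★ `CechComplexExactOfFibrewiseExact` ((E1) at maximal ideals), ★ `GrothendieckComplexOfProper` (§2 affine base change), ★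
  `VanishingBaseChangeOfQuasiIso` (`exactAt_extendScalars_iff`, `function_exact_baseChange_iff_of_linearEquiv`).
-/

set_option autoImplicit false

open CategoryTheory CategoryTheory.Limits AlgebraicGeometry TensorProduct Module
open Literature.Algebra.Homology

noncomputable section

namespace Literature.AlgebraicGeometry.Modules

open Literature.AlgebraicGeometry.Morphisms Literature.AlgebraicGeometry.HodgeTheory Literature.AlgebraicGeometry.Motives

/-! ### §1 `k`-points of an affine `k`-scheme of finite type over an algebraically closed field -/

section KPoints

variable {k : Type} [Field k] {B : Scheme.{0}} [IsAffine B]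

/-- **Nullstellensatz on the sections**: for `f : B → Spec k` affine of finite type, `k = k̄`, every maximal ideal of `Γ(B, 𝒪_B)` is the kernel of a
`k`-algebra map `Γ(B, 𝒪_B) → k` (for the `k`-algebra structure `k ≅ Γ(Spec k) —f♯→ Γ(B)`; Zariski's lemma: `Γ(B)⧸𝔪` is finite over `k`, hence `= k`).
[cite: GortzWedhorn2020, Cor. 3.36] [cite: AtiyahMacdonald1969, Ch. 5 Cor. 5.24] -/
theorem exists_algHom_ker_eq_of_isMaximal_sections [IsAlgClosed k] (f : B ⟶ Spec (.of k)) [LocallyOfFiniteType f]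
    (m : Ideal Γ(B, ⊤)) [m.IsMaximal] :
    letI := ((Scheme.ΓSpecIso (.of k)).inv ≫ f.appTop).hom.toAlgebra
    ∃ ev : Γ(B, ⊤) →ₐ[k] k, RingHom.ker ev.toRingHom = m := by
  letI := ((Scheme.ΓSpecIso (.of k)).inv ≫ f.appTop).hom.toAlgebra
  haveI : Algebra.FiniteType k Γ(B, ⊤) := by
    have h1 : RingHom.FiniteType f.appTop.hom := HasRingHomProperty.appTop (P := @LocallyOfFiniteType) f inferInstance
    have h2 : RingHom.FiniteType (Scheme.ΓSpecIso (.of k)).inv.hom :=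
      RingHom.FiniteType.of_surjective _ (ConcreteCategory.bijective_of_isIso (Scheme.ΓSpecIso (.of k)).inv).2
    exact h1.comp h2
  letI : Field (Γ(B, ⊤) ⧸ m) := Ideal.Quotient.field m
  haveI : Module.Finite k (Γ(B, ⊤) ⧸ m) := finite_of_finite_type_of_isJacobsonRing k (Γ(B, ⊤) ⧸ m)
  haveI : Algebra.IsIntegral k (Γ(B, ⊤) ⧸ m) := Algebra.IsIntegral.of_finite k _
  have hbij : Function.Bijective (algebraMap k (Γ(B, ⊤) ⧸ m)) := IsAlgClosed.algebraMap_bijective_of_isIntegral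
  let e : k ≃ₐ[k] Γ(B, ⊤) ⧸ m := AlgEquiv.ofBijective (Algebra.ofId k (Γ(B, ⊤) ⧸ m)) hbij
  refine ⟨(e.symm : (Γ(B, ⊤) ⧸ m) →ₐ[k] k).comp (Ideal.Quotient.mkₐ k m), ?_⟩
  ext a
  rw [RingHom.mem_ker]
  change e.symm (Ideal.Quotient.mk m a) = 0 ↔ a ∈ m
  rw [map_eq_zero_iff _ e.symm.injective, Ideal.Quotient.eq_zero_iff_mem]

/-- **The point of a ring map `ev : Γ(B) → k` on the affine `B`, `b_ev := Spec ev ≫ B.isoSpec⁻¹`, pulls sections back by `ev`**: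
`b_ev♯ = ev ≫ (ΓSpecIso k)⁻¹` on global sections (in the `appLE ⊤ ⊤` form of ★ `GrothendieckComplexOfProper` §2).
[cite: GortzWedhorn2020, Section (4.7) and Prop. 3.4] -/
theorem appLE_specMap_comp_isoSpec_inv (ev : Γ(B, ⊤) →+* k) :
    (Spec.map (CommRingCat.ofHom ev) ≫ B.isoSpec.inv).appLE ⊤ ⊤ le_top =
      CommRingCat.ofHom ev ≫ (Scheme.ΓSpecIso (.of k)).inv := by
  have happ : (Spec.map (CommRingCat.ofHom ev) ≫ B.isoSpec.inv).appTop =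
      CommRingCat.ofHom ev ≫ (Scheme.ΓSpecIso (.of k)).inv := by
    rw [Scheme.Hom.comp_appTop]
    have h1 : B.isoSpec.inv.appTop = (Scheme.ΓSpecIso Γ(B, ⊤)).inv := by
      have : B.isoSpec.inv = inv B.toSpecΓ := rfl
      rw [this, Scheme.Hom.inv_appTop]
      simp only [Scheme.toSpecΓ_appTop, IsIso.Iso.inv_hom]
    rw [h1]
    have h2 := Scheme.ΓSpecIso_naturality (CommRingCat.ofHom ev : Γ(B, ⊤) ⟶ CommRingCat.of k)
    rw [← Iso.eq_comp_inv] at h2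
    rw [h2, Category.assoc, Iso.inv_hom_id_assoc]
  rw [← happ, Scheme.Hom.appTop, Scheme.Hom.app_eq_appLE]
  rfl

/-- **`b_ev` lies over `k`** when `ev` is a `k`-algebra map (for the `k`-structure `f`): `b_ev ≫ f = 𝟙_{Spec k}` (compare global sections,
Mathlib `ext_of_isAffine`). [cite: GortzWedhorn2020, Prop. 3.4 and Cor. 3.36] -/
theorem specMap_comp_isoSpec_inv_comp_eq_id (f : B ⟶ Spec (.of k)) (ev : Γ(B, ⊤) →+* k)
    (hev : ev.comp ((Scheme.ΓSpecIso (.of k)).inv ≫ f.appTop).hom = RingHom.id k) :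
    (Spec.map (CommRingCat.ofHom ev) ≫ B.isoSpec.inv) ≫ f = 𝟙 _ := by
  apply ext_of_isAffine
  have happ : (Spec.map (CommRingCat.ofHom ev) ≫ B.isoSpec.inv).appTop = CommRingCat.ofHom ev ≫ (Scheme.ΓSpecIso (.of k)).inv := by
    have h := appLE_specMap_comp_isoSpec_inv (B := B) ev
    rw [Scheme.Hom.appTop, Scheme.Hom.app_eq_appLE]
    exact h
  rw [Scheme.Hom.comp_appTop, happ, Scheme.Hom.id_appTop]
  have hf : f.appTop ≫ CommRingCat.ofHom ev = (Scheme.ΓSpecIso (.of k)).hom := by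
    have h : (Scheme.ΓSpecIso (.of k)).inv ≫ (f.appTop ≫ CommRingCat.ofHom ev) = 𝟙 _ := by
      ext x
      change ev (((Scheme.ΓSpecIso (.of k)).inv ≫ f.appTop).hom x) = x
      exact congrArg (fun φ : k →+* k => φ x) hev
    rw [(Iso.inv_comp_eq _).1 h, Category.comp_id]
  rw [← Category.assoc, hf, Iso.hom_inv_id]

/-- **The two test algebras at a `k`-point agree**: for `ev : Γ(B) → k` SURJECTIVE with kernel the maximal ideal `𝔪`, the residue field
`κ(𝔪)` (Mathlib `Ideal.ResidueField`) and `Γ(Spec k, 𝒪)` — a `Γ(B)`-algebra through `b_ev♯` — are `Γ(B)`-linearly isomorphic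
(`κ(𝔪) ≃ Γ(B)⧸𝔪 ≃ k ≃ Γ(Spec k, 𝒪)`: Mathlib `Ideal.bijective_algebraMap_quotient_residueField`, `Ideal.quotientKerAlgEquivOfSurjective`, `ΓSpecIso`).
[cite: AtiyahMacdonald1969, Ch. 3 Prop. 3.5 and Ch. 1 (residue fields)] -/
theorem nonempty_residueField_linearEquiv_sections_spec (ev : Γ(B, ⊤) →+* k) (hsurj : Function.Surjective ev)
    (m : Ideal Γ(B, ⊤)) [m.IsMaximal] (hker : RingHom.ker ev = m) :
    letI := ((Spec.map (CommRingCat.ofHom ev) ≫ B.isoSpec.inv).appLE ⊤ ⊤ le_top).hom.toAlgebra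
    Nonempty (m.ResidueField ≃ₗ[Γ(B, ⊤)] Γ(Spec (.of k), ⊤)) := by
  letI alg := ((Spec.map (CommRingCat.ofHom ev) ≫ B.isoSpec.inv).appLE ⊤ ⊤ le_top).hom.toAlgebra
  letI algk : Algebra Γ(B, ⊤) k := ev.toAlgebra
  have hβ : ∀ r : Γ(B, ⊤), algebraMap Γ(B, ⊤) Γ(Spec (.of k), ⊤) r = (Scheme.ΓSpecIso (.of k)).inv.hom (ev r) := fun r => by
    change ((Spec.map (CommRingCat.ofHom ev) ≫ B.isoSpec.inv).appLE ⊤ ⊤ le_top).hom r = _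
    rw [appLE_specMap_comp_isoSpec_inv]
    rfl
  let e1 : k ≃ₗ[Γ(B, ⊤)] Γ(Spec (.of k), ⊤) :=
    { (Scheme.ΓSpecIso (.of k)).commRingCatIsoToRingEquiv.symm.toAddEquiv with
      map_smul' := fun r x => by
        change (Scheme.ΓSpecIso (.of k)).inv.hom (ev r * x) = algebraMap _ _ r * (Scheme.ΓSpecIso (.of k)).inv.hom x
        rw [map_mul, hβ] }
  have hsurj' : Function.Surjective (Algebra.ofId Γ(B, ⊤) k) := hsurj
  let e2 : (Γ(B, ⊤) ⧸ RingHom.ker (Algebra.ofId Γ(B, ⊤) k)) ≃ₐ[Γ(B, ⊤)] k := Ideal.quotientKerAlgEquivOfSurjective hsurj'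
  have hker' : RingHom.ker (Algebra.ofId Γ(B, ⊤) k) = m := hker
  let e3 : (Γ(B, ⊤) ⧸ m) ≃ₐ[Γ(B, ⊤)] (Γ(B, ⊤) ⧸ RingHom.ker (Algebra.ofId Γ(B, ⊤) k)) :=
    Ideal.quotientEquivAlgOfEq Γ(B, ⊤) hker'.symm
  let e4 : (Γ(B, ⊤) ⧸ m) ≃ₗ[Γ(B, ⊤)] m.ResidueField :=
    LinearEquiv.ofBijective ((Algebra.ofId (Γ(B, ⊤) ⧸ m) m.ResidueField).toLinearMap.restrictScalars Γ(B, ⊤))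
      (Ideal.bijective_algebraMap_quotient_residueField m)
  exact ⟨e4.symm ≪≫ₗ e3.toLinearEquiv ≪≫ₗ e2.toLinearEquiv ≪≫ₗ e1⟩

end KPoints

/-! ### §2 (E1′) fibrewise exact at every `k`-point ⇒ exact after every base change -/

section E1prime

variable {k : Type} [Field k] [IsAlgClosed k] {X B : Scheme.{0}} (g : X ⟶ B) (f : B ⟶ Spec (.of k))
  [IsAffine B] [LocallyOfFiniteType f] [IsProper g] [Flat g]
  {ι : Type} [LinearOrder ι] [Fintype ι] (U : ι → X.Opens) (hcov : ⨆ i, U i = ⊤)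
  (hUa : ∀ s : Finset ι, s.Nonempty → IsAffineOpen (cechOpen U s)) (G : X.Modules) (hL : IsFiniteLocallyFree G)

include hcov hUa hL in
/-- **(E1′) FIBREWISE EXACT AT EVERY `k`-POINT ⇒ EXACT AFTER EVERY BASE CHANGE**: `g : X → B` proper flat, `f : B → Spec k` affine of finite
type, `k` algebraically closed, `G` finite locally free, `𝓤` a finite cover of `X` with affine finite intersections, `C• := Č•(𝓤, G)` with scalars
`g♯ : Γ(B) → Γ(X)`.  If for every `k`-point `b : Spec k → B` over `k` the fibre Čech complex
`Č•((pr_X⁻¹ U_j)_j, pr_X^* G)` of `X_b = pullback g b` (scalars `pr_{Spec k}♯`) is exact in every degree `i ≥ q`, then `C• ⊗_{Γ(B)} B'` is exact in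
every degree `i ≥ q` for EVERY `Γ(B)`-algebra `B'`. [cite: MumfordAV1970, §5 Cor. 3 (p. 53)] [cite: Hartshorne1977, III Thm. 12.11 (p. 290)]
[cite: GortzWedhorn2020, Cor. 3.36] [cite: GortzWedhorn2023, Prop. 22.90 (p. 277)] -/
theorem cechComplex_exact_baseChange_of_forall_kPoint (q : ℤ)
    (hfib : ∀ (b : Spec (.of k) ⟶ B), b ≫ f = 𝟙 _ → ∀ i, q ≤ i →
      (cechComplex (fun j => (pullback.fst g b) ⁻¹ᵁ U j) ((Scheme.Modules.pullback (pullback.fst g b)).obj G)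
        (pullback.snd g b).appTop.hom).ExactAt i)
    (B' : Type) [CommRing B'] [Algebra Γ(B, ⊤) B'] (i : ℤ) (hi : q ≤ i) :
    Function.Exact (((cechComplex U G g.appTop.hom).d (i - 1) i).hom.baseChange B')
      (((cechComplex U G g.appTop.hom).d i (i + 1)).hom.baseChange B') := by
  haveI : IsLocallyNoetherian B := LocallyOfFiniteType.isLocallyNoetherian f
  refine cechComplex_exact_baseChange_of_forall_isMaximal g U hcov hUa G hL q (fun m _ j hj => ?_) B' i hi
  -- a `k`-point through the maximal ideal `m`
  letI algk := ((Scheme.ΓSpecIso (.of k)).inv ≫ f.appTop).hom.toAlgebra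
  obtain ⟨ev, hev⟩ := exists_algHom_ker_eq_of_isMaximal_sections f m
  let b : Spec (.of k) ⟶ B := Spec.map (CommRingCat.ofHom ev.toRingHom) ≫ B.isoSpec.inv
  have hb : b ≫ f = 𝟙 _ := specMap_comp_isoSpec_inv_comp_eq_id f ev.toRingHom ev.comp_algebraMap
  have hsurj : Function.Surjective ev.toRingHom := fun c => ⟨algebraMap k Γ(B, ⊤) c, ev.commutes c⟩
  -- the fibre complex at `b` is `C• ⊗ Γ(Spec k)` (affine base change), exact in degree `j`
  have hGa : IsAffineLocalizing G := by
    haveI := hL.isVectorBundle.1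
    exact IsAffineLocalizing.of_isQuasicoherent G
  letI algb := (b.appLE ⊤ ⊤ le_top).hom.toAlgebra
  obtain ⟨Φ, -⟩ := exists_extendScalars_cechComplex_iso_of_isPullback (IsPullback.of_hasPullback g b) U hUa G hGa
  have hext := ((hfib b hb j hj).of_iso Φ.symm)
  rw [exactAt_extendScalars_iff] at hext
  -- move the test algebra from `Γ(Spec k)` to `κ(m)`
  obtain ⟨e⟩ := nonempty_residueField_linearEquiv_sections_spec (B := B) ev.toRingHom hsurj m hev
  exact (function_exact_baseChange_iff_of_linearEquiv e _ _).2 hext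

include hcov hUa hL in
/-- **(E1′) corollary: `Hⁱ(Č•(𝓤, G)) = 0` for `i ≥ q`** when every `k`-point fibre is acyclic in degrees `≥ q` — Step 1 of [MumfordAV1970] §8 Thm. 1
(«fibrewise acyclic ⇒ acyclic») on an affine base piece. [cite: MumfordAV1970, §5 Cor. 3 (p. 53); §8 Thm. 1 (p. 77)] -/
theorem cechComplex_exactAt_of_forall_kPoint (q : ℤ)
    (hfib : ∀ (b : Spec (.of k) ⟶ B), b ≫ f = 𝟙 _ → ∀ i, q ≤ i →
      (cechComplex (fun j => (pullback.fst g b) ⁻¹ᵁ U j) ((Scheme.Modules.pullback (pullback.fst g b)).obj G)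
        (pullback.snd g b).appTop.hom).ExactAt i)
    (i : ℤ) (hi : q ≤ i) : (cechComplex U G g.appTop.hom).ExactAt i := by
  rw [exactAt_iff_function_exact (cechComplex U G g.appTop.hom) (i - 1) i (i + 1) (by omega) rfl]
  exact (function_exact_baseChange_self_iff _ _).1
    (cechComplex_exact_baseChange_of_forall_kPoint g f U hcov hUa G hL q hfib Γ(B, ⊤) i hi)

end E1prime

/-! ### §3 (E1″) the point form of the conclusion: exact after every base change ⇒ every fibre Čech complex exact -/

section E1doubleprime

variable {X B : Scheme.{0}} (g : X ⟶ B) [IsAffine B]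
  {ι : Type} [LinearOrder ι] [Fintype ι] (U : ι → X.Opens)
  (hUa : ∀ s : Finset ι, s.Nonempty → IsAffineOpen (cechOpen U s)) (G : X.Modules) (hL : IsFiniteLocallyFree G)

include hUa hL in
/-- **(E1″) EXACT AFTER EVERY BASE CHANGE ⇒ EXACT ON EVERY FIBRE**: if `Č•(𝓤, G) ⊗_{Γ(B)} B'` is exact in every degree `i ≥ q` for every
`Γ(B)`-algebra `B'`, then for every field-valued point `b : Spec K → B` (ANY field `K`) the fibre Čech complex of `X_b = pullback g b` is exact in
every degree `i ≥ q` (affine base change ★ `exists_extendScalars_cechComplex_iso_of_isPullback` at `B' := Γ(Spec K, 𝒪)`).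
[cite: MumfordAV1970, §5 Cor. 3 (p. 53)] [cite: GortzWedhorn2023, Prop. 22.90 (p. 277)] -/
theorem cechComplex_fibre_exactAt_of_forall_exact_baseChange (q : ℤ)
    (hall : ∀ (B' : Type) [CommRing B'] [Algebra Γ(B, ⊤) B'], ∀ i, q ≤ i →
      Function.Exact (((cechComplex U G g.appTop.hom).d (i - 1) i).hom.baseChange B')
        (((cechComplex U G g.appTop.hom).d i (i + 1)).hom.baseChange B'))
    {K : Type} [Field K] (b : Spec (.of K) ⟶ B) (i : ℤ) (hi : q ≤ i) :
    (cechComplex (fun j => (pullback.fst g b) ⁻¹ᵁ U j) ((Scheme.Modules.pullback (pullback.fst g b)).obj G)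
      (pullback.snd g b).appTop.hom).ExactAt i := by
  have hGa : IsAffineLocalizing G := by
    haveI := hL.isVectorBundle.1
    exact IsAffineLocalizing.of_isQuasicoherent G
  letI algb := (b.appLE ⊤ ⊤ le_top).hom.toAlgebra
  obtain ⟨Φ, -⟩ := exists_extendScalars_cechComplex_iso_of_isPullback (IsPullback.of_hasPullback g b) U hUa G hGa
  have hext : (((ModuleCat.extendScalars (b.appLE ⊤ ⊤ le_top).hom).mapHomologicalComplex (ComplexShape.up ℤ)).obj
      (cechComplex U G g.appTop.hom)).ExactAt i := by
    rw [exactAt_extendScalars_iff]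
    exact hall _ i hi
  exact hext.of_iso Φ

end E1doubleprime

section E1triple

variable {k : Type} [Field k] [IsAlgClosed k] {X B : Scheme.{0}} (g : X ⟶ B) (f : B ⟶ Spec (.of k))
  [IsAffine B] [LocallyOfFiniteType f] [IsProper g] [Flat g]
  {ι : Type} [LinearOrder ι] [Fintype ι] (U : ι → X.Opens) (hcov : ⨆ i, U i = ⊤)
  (hUa : ∀ s : Finset ι, s.Nonempty → IsAffineOpen (cechOpen U s)) (G : X.Modules) (hL : IsFiniteLocallyFree G)

include hcov hUa hL in
/-- **(E1′) ∘ (E1″)**: exact on every `k`-point fibre over `k = k̄` ⇒ exact on EVERY field-valued fibre (any field `K`, any `b : Spec K → B`).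
[cite: MumfordAV1970, §5 Cor. 3 (p. 53)] -/
theorem cechComplex_fibre_exactAt_of_forall_kPoint (q : ℤ)
    (hfib : ∀ (b : Spec (.of k) ⟶ B), b ≫ f = 𝟙 _ → ∀ i, q ≤ i →
      (cechComplex (fun j => (pullback.fst g b) ⁻¹ᵁ U j) ((Scheme.Modules.pullback (pullback.fst g b)).obj G)
        (pullback.snd g b).appTop.hom).ExactAt i)
    {K : Type} [Field K] (b : Spec (.of K) ⟶ B) (i : ℤ) (hi : q ≤ i) :
    (cechComplex (fun j => (pullback.fst g b) ⁻¹ᵁ U j) ((Scheme.Modules.pullback (pullback.fst g b)).obj G)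
      (pullback.snd g b).appTop.hom).ExactAt i :=
  cechComplex_fibre_exactAt_of_forall_exact_baseChange g U hUa G hL q
    (fun B' _ _ j hj => cechComplex_exact_baseChange_of_forall_kPoint g f U hcov hUa G hL q hfib B' j hj) b i hi

end E1triple

end Literature.AlgebraicGeometry.Modules

end
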